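/-
Origin: expansion seat `planner-pub-hodgecm-qw8-g11-0`, handover #4 REPLACE (DOC-ONLY) md5 f2ce5a9fd74604d0fea149cc0c691717 (239 l.) SUPERSEDES tree `HodgeCM/Model/Toy/BalMod.lean` 341c7a68 (215 l.): docstrings added to every undocumented theorem/def (CONVENTIONS §3 debt → 0), comment-stripped code IDENTICAL to the tree copy (residue md5 cdc46feb; no declaration, statement or proof changed); imports unchanged (Mathlib, HodgeCM.StubTree.Qw8GysinDescentH0; NO rew (`HOME/pub-hodgecm-qw8-g11/lean/Qw8g11/BalMod.lean`, md5 f2ce5a9f, 239 lines);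
landed by the packager successor (mc-unitary-1-g3, gen-8 kit) in gate run 32 REPLACES the earlier landed copy of `HodgeCM/Model/Toy/BalMod.lean` (seat copy carried the packager origin header of the earlier run (stripped)).
-/
-- HANDOVER (planner-pub-hodgecm-qw8-g6-0, unit pub-hodgecm-qw8-g6): WIP module `Qw8g6.BalMod`; intended final module
-- `HodgeCM.Model.Toy.BalMod` (kind L5, separating model); rename `import Qw8g6.X` ↦ `import HodgeCM.Model.Toy.X`.
/-
Copyright: pub-hodgecm cell (HodgeCMPerL). Separating-model layer (gen 6 of the [QW8] §2.5 lineage). New file.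

# `U.balMod B C`: cutting the algebraic classes down to `Alg^p(X) ⊓ B^p(X)`

For ANY universe `U`, a family of `ℚ`-subspaces `B^p(X) ⊆ H^{2p}(X, ℚ)` and a predicate `C` on varieties,
`U.balMod B C` is `U` with `alg X p := U.alg X p ⊓ B X p` and `IsCMAbelianVariety X := U.IsCMAbelianVariety X ∨ C X`;
everything else (cohomology, Hodge structures, morphisms, cup, trace, products, CM objects) is untouched.

This file is the GENERIC bookkeeping (abstract `U`, so every transfer is a one-line unfolding, exactly as in
`HodgeCM.Model.Toy.TruncAlgAt`): the statements of `ModelAxioms`, N1–N4, F4, F5, F-H0, F7d-B and `Fact_dimProd` for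
`U.balMod B C` reduce to those of `U` plus closure properties of `B` (pull-back, cup product, Lefschetz (1,1), descent).
The instance `lefModel` (the exterior CM-model with `B` = the balanced classes) is `HodgeCM.Model.Toy.LefModel`.
-/
import Mathlib
import Summits.HodgeConjecture.HodgeCM.StubTree.Qw8GysinDescentH0

/-! PORT of `HodgeCM/Model/Toy/BalMod.lean` (HodgeCMPerL run 82) — verbatim mechanical port; provenance in the PORT header line. -/

noncomputable section

open scoped TensorProduct

namespace HodgeCM

open Literature.AlgebraicGeometry.Motives (CMType)

namespace Universe

variable (U : Universe) (B : (X : U.Var) → (p : ℕ) → Submodule ℚ (U.Coh X (2 * p))) (C : U.Var → Prop)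

/-- `U` with `Alg^p(X)` replaced by `Alg^p(X) ⊓ B^p(X)` and the CM predicate enlarged by `C`. -/
@[reducible] def balMod : Universe :=
  { U with
    alg := fun X p => U.alg X p ⊓ B X p
    IsCMAbelianVariety := fun X => U.IsCMAbelianVariety X ∨ C X }

/-- The algebraic classes of `U.balMod B C` are `Alg^p(X) ⊓ B^p(X)` (by definition). -/
theorem balMod_alg (X : U.Var) (p : ℕ) : (U.balMod B C).alg X p = U.alg X p ⊓ B X p := rfl

/-- Membership in the algebraic classes of `U.balMod B C`: algebraic in `U` and in `B^p(X)`. -/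
theorem mem_balMod_alg {X : U.Var} {p : ℕ} (x : U.Coh X (2 * p)) :
    x ∈ (U.balMod B C).alg X p ↔ x ∈ U.alg X p ∧ x ∈ B X p := Submodule.mem_inf

/-- The CM predicate of `U.balMod B C` is `U`'s CM predicate enlarged by `C` (by definition). -/
theorem balMod_isCM (X : U.Var) : (U.balMod B C).IsCMAbelianVariety X ↔ (U.IsCMAbelianVariety X ∨ C X) :=
  Iff.rfl

/-- The algebraic classes of `U.balMod B C` are contained in those of `U`. -/
theorem balMod_alg_le (X : U.Var) (p : ℕ) : (U.balMod B C).alg X p ≤ U.alg X p := inf_le_left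

/-- The algebraic classes of `U.balMod B C` are contained in `B^p(X)`. -/
theorem balMod_alg_le_B (X : U.Var) (p : ℕ) : (U.balMod B C).alg X p ≤ B X p := inf_le_right

/-- The trace map is untouched by `balMod`. -/
@[simp] theorem balMod_tr (X : U.Var) (k : ℕ) : (U.balMod B C).tr X k = U.tr X k := rfl

/-- Dimensions are untouched by `balMod`. -/
theorem balMod_dim (X : U.Var) : (U.balMod B C).dim X = U.dim X := rfl

/-- Hodge classes are untouched by `balMod` (only `alg` and the CM predicate change). -/
theorem balMod_hodgeClassesOf (X : U.Var) (p : ℕ) : (U.balMod B C).hodgeClassesOf X p = U.hodgeClassesOf X p :=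
  rfl

set_option smartUnfolding false in
/-- The CM products `cmProd F Θ` are untouched by `balMod`. -/
theorem balMod_cmProd (F : CMField) {n : ℕ} (Θ : Fin (n + 1) → CMType F) :
    (U.balMod B C).cmProd F Θ = U.cmProd F Θ := rfl

/-! ### The Hodge conjecture and the face statements in `U.balMod B C` -/

/-- The Hodge conjecture for `X` in `U.balMod B C` says: every Hodge class lies in `Alg^p(X) ⊓
B^p(X)`. -/
theorem balMod_hc_iff (X : U.Var) : (U.balMod B C).HC X ↔ ∀ p : ℕ, U.hodgeClassesOf X p ≤ U.alg X p ⊓ B X p :=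
  Iff.rfl

/-- `HC_CM` in `U.balMod B C` unfolded: for every variety that is CM in `U` or satisfies `C`, every
Hodge class lies in `Alg^p(X) ⊓ B^p(X)`. -/
theorem balMod_hc_cm_iff :
    (U.balMod B C).HC_CM ↔ ∀ X : U.Var, (U.IsCMAbelianVariety X ∨ C X) → ∀ p : ℕ,
      U.hodgeClassesOf X p ≤ U.alg X p ⊓ B X p :=
  Iff.rfl

/-- The Weil lines `weilLine K Φ` are untouched by `balMod`. -/
theorem balMod_weilLine (K : CMField) (Φ : Fin 4 → CMType K) : (U.balMod B C).weilLine K Φ = U.weilLine K Φ := rfl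

/-- Algebraicity of a Weil face in `U.balMod B C` unfolded: the Weil line of the corner lies in
`Alg² ⊓ B²` of the fourfold product. -/
theorem balMod_weilFaceAlgebraic_iff (K : CMField) (f : Face K) :
    (U.balMod B C).WeilFaceAlgebraic K f ↔
      U.weilLine K f.corner ≤ U.alg (U.prod4 K f.corner) 2 ⊓ B (U.prod4 K f.corner) 2 :=
  Iff.rfl

/-! ### Unchanged statements -/

set_option smartUnfolding false in
/-- `Fact_cupExterior` transfers verbatim between `U` and `U.balMod B C` (it does not mention
`alg`). -/
theorem balMod_fact_cupExterior_iff : (U.balMod B C).Fact_cupExterior ↔ U.Fact_cupExterior := Iff.rfl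
/-- `Fact_cup_hodge` transfers verbatim between `U` and `U.balMod B C`. -/
theorem balMod_fact_cup_hodge_iff : (U.balMod B C).Fact_cup_hodge ↔ U.Fact_cup_hodge := Iff.rfl
/-- `Fact_pull_H0` transfers verbatim between `U` and `U.balMod B C`. -/
theorem balMod_fact_pull_H0_iff : (U.balMod B C).Fact_pull_H0 ↔ U.Fact_pull_H0 := Iff.rfl
/-- `Fact_hodge_F0` transfers verbatim between `U` and `U.balMod B C`. -/
theorem balMod_fact_hodge_F0_iff : (U.balMod B C).Fact_hodge_F0 ↔ U.Fact_hodge_F0 := Iff.rfl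
/-- `Fact_cupAssoc` transfers verbatim between `U` and `U.balMod B C`. -/
theorem balMod_fact_cupAssoc_iff : (U.balMod B C).Fact_cupAssoc ↔ U.Fact_cupAssoc := Iff.rfl
/-- `Fact_dimProd` transfers verbatim between `U` and `U.balMod B C`. -/
theorem balMod_fact_dimProd_iff : (U.balMod B C).Fact_dimProd ↔ U.Fact_dimProd := Iff.rfl
set_option smartUnfolding false in
/-- `Fact_unitH0` transfers verbatim between `U` and `U.balMod B C`. -/
theorem balMod_fact_unitH0_iff : (U.balMod B C).Fact_unitH0 ↔ U.Fact_unitH0 := Iff.rfl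

/-! ### The 28 model facts -/

variable {U B C}

/-- **`ModelAxioms (U.balMod B C)` from `ModelAxioms U`** and the closure of `B` under pull-back, the cup product
of divisor classes and Lefschetz (1,1), given M17, M26, M28 for the new universe. -/
theorem ModelAxioms.balMod (M : U.ModelAxioms)
    (hpull : ∀ (X Y : U.Var) (f : U.Mor X Y) (p : ℕ), (B Y p).map (U.pull f (2 * p)) ≤ B X p)
    (hcup : ∀ (X : U.Var) (x y : U.Coh X 2), x ∈ B X 1 → y ∈ B X 1 → U.cup X 2 2 x y ∈ B X 2)
    (h11 : ∀ X : U.Var, U.hodgeClassesOf X 1 ≤ B X 1)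
    (hdom : (U.balMod B C).Fact_cmDominated) (hsurf : (U.balMod B C).Fact_gysin_surface)
    (hdual : (U.balMod B C).Fact_algDuality) : (U.balMod B C).ModelAxioms where
  pull_id := M.pull_id
  pull_comp := M.pull_comp
  pull_cup := M.pull_cup
  pull_hodge := M.pull_hodge
  cup2_hodge := M.cup2_hodge
  tr_degree := M.tr_degree
  alg_le_hodge := fun X p => (U.balMod_alg_le B C X p).trans (M.alg_le_hodge X p)
  pull_alg := fun X Y f p => by
    show (U.alg Y p ⊓ B Y p).map (U.pull f (2 * p)) ≤ U.alg X p ⊓ B X p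
    exact le_inf ((Submodule.map_mono inf_le_left).trans (M.pull_alg X Y f p))
      ((Submodule.map_mono inf_le_right).trans (hpull X Y f p))
  cup_alg := fun X x y hx hy => by
    have hx' : x ∈ U.alg X 1 ⊓ B X 1 := hx
    have hy' : y ∈ U.alg X 1 ⊓ B X 1 := hy
    show U.cup X 2 2 x y ∈ U.alg X 2 ⊓ B X 2
    exact Submodule.mem_inf.mpr
      ⟨M.cup_alg X x y (Submodule.mem_inf.mp hx').1 (Submodule.mem_inf.mp hy').1,
        hcup X x y (Submodule.mem_inf.mp hx').2 (Submodule.mem_inf.mp hy').2⟩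
  lefschetz11 := fun X => by
    show U.hodgeClassesOf X 1 ≤ U.alg X 1 ⊓ B X 1
    exact le_inf (M.lefschetz11 X) (h11 X)
  cmAV := fun K Φ => ⟨(M.cmAV K Φ).1, Or.inl (M.cmAV K Φ).2.1, (M.cmAV K Φ).2.2⟩
  eigenLine := M.eigenLine
  alphaLine := M.alphaLine
  cmDominated := hdom
  weilLine_rank := M.weilLine_rank
  weilLine_hodge := M.weilLine_hodge
  pms_dim := M.pms_dim
  lift := M.lift
  cup_comm1 := M.cup_comm1
  cup_interchange := M.cup_interchange
  kunneth1 := M.kunneth1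
  H1_rank := M.H1_rank
  H4_span := M.H4_span
  cmEnd := M.cmEnd
  conjIsogeny := M.conjIsogeny
  gysin_surface := hsurf
  deg_diag := M.deg_diag
  algDuality := hdual

/-- M26 for `U.balMod B C` when `U` is trace-free (Gysin class `0`). -/
theorem balMod_fact_gysin_surface (h0 : ∀ (X : U.Var) (k : ℕ), U.tr X k = 0) :
    (U.balMod B C).Fact_gysin_surface := fun S X f _ =>
  ⟨0, Submodule.zero_mem _, fun y => by
    show U.tr S 4 _ = U.tr X _ _
    rw [h0, h0, LinearMap.zero_apply, LinearMap.zero_apply]⟩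

set_option smartUnfolding false in
/-- M17 for `U.balMod B C`: the old CM varieties are dominated as before, the new ones by hypothesis. -/
theorem balMod_fact_cmDominated (h : U.Fact_cmDominated)
    (hC : ∀ X : U.Var, C X →
      ∃ F : CMField, IsGalois ℚ F ∧ 6 ≤ Module.finrank ℚ F ∧
        ∃ (n : ℕ) (Θ : Fin (n + 1) → CMType F) (s : U.Mor X (U.cmProd F Θ))
          (π : U.Mor (U.cmProd F Θ) X) (N : ℕ), N ≠ 0 ∧
            ∀ k : ℕ, U.pull (U.comp s π) k = ((N : ℚ) ^ k) • LinearMap.id) :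
    (U.balMod B C).Fact_cmDominated := by
  rintro X (hX | hX)
  · exact h X hX
  · exact hC X hX

/-! ### F4 and F7d-B -/

/-- **F4 for `U.balMod B C`**: from F4 for `U` and the multiplicativity of `B`. -/
theorem Fact_cupAlg.balMod (h : U.Fact_cupAlg)
    (hB : ∀ (X : U.Var) (p q : ℕ) (x : U.Coh X (2 * p)) (y : U.Coh X (2 * q)), x ∈ B X p → y ∈ B X q →
      U.castCoh X (by omega) (U.cup X (2 * p) (2 * q) x y) ∈ B X (p + q)) :
    (U.balMod B C).Fact_cupAlg := by
  intro X p q x y hx hy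
  have hx' : x ∈ U.alg X p ⊓ B X p := hx
  have hy' : y ∈ U.alg X q ⊓ B X q := hy
  show U.castCoh X _ (U.cup X (2 * p) (2 * q) x y) ∈ U.alg X (p + q) ⊓ B X (p + q)
  exact Submodule.mem_inf.mpr
    ⟨h X p q x y (Submodule.mem_inf.mp hx').1 (Submodule.mem_inf.mp hy').1,
      hB X p q x y (Submodule.mem_inf.mp hx').2 (Submodule.mem_inf.mp hy').2⟩

variable (U B) in
/-- the `B`-half of F7d-B: `p_Y^* e ∪ p_{Y'}^* ω ∈ B(P) ⇒ e ∈ B(Y)` for a block pair and a top class `ω ≠ 0`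
(stated OUTSIDE the `smartUnfolding false` scope of `Fact_gysinDescentB.balMod`, so that the implicit length
index of `cmProd` elaborates to the same term as in `Universe.Fact_gysinDescentB`). -/
def BalDescentB : Prop :=
  ∀ (F : CMField) (n m : ℕ) (Ξ : Fin (n + 1 + (m + 1)) → CMType F)
    (pA : U.Mor (U.cmProd F Ξ) (U.cmProd F (blkA Ξ))) (pB : U.Mor (U.cmProd F Ξ) (U.cmProd F (blkB Ξ))),
    U.IsBlockPair F Ξ pA pB →
    ∀ ω : U.Coh (U.cmProd F (blkB Ξ)) (2 * U.dim (U.cmProd F (blkB Ξ))), ω ≠ 0 →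
      ∀ (p : ℕ) (e : U.Coh (U.cmProd F (blkA Ξ)) (2 * p)),
        U.castCoh (U.cmProd F Ξ)
            (by omega : 2 * p + 2 * U.dim (U.cmProd F (blkB Ξ)) = 2 * (p + U.dim (U.cmProd F (blkB Ξ))))
            (U.cup (U.cmProd F Ξ) (2 * p) _ (U.pull pA (2 * p) e) (U.pull pB _ ω)) ∈
          B (U.cmProd F Ξ) (p + U.dim (U.cmProd F (blkB Ξ))) →
        e ∈ B (U.cmProd F (blkA Ξ)) p

set_option smartUnfolding false in
/-- **F7d-B for `U.balMod B C`**: from F7d-B for `U` and the same descent for `B`. -/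
theorem Fact_gysinDescentB.balMod (h : U.Fact_gysinDescentB) (hB : U.BalDescentB B) :
    (U.balMod B C).Fact_gysinDescentB := by
  intro F n m Ξ pA pB hP ω hω p e he
  have he' : U.castCoh (U.cmProd F Ξ)
      (by omega : 2 * p + 2 * U.dim (U.cmProd F (blkB Ξ)) = 2 * (p + U.dim (U.cmProd F (blkB Ξ))))
      (U.cup (U.cmProd F Ξ) (2 * p) _ (U.pull pA (2 * p) e) (U.pull pB _ ω)) ∈
        U.alg (U.cmProd F Ξ) (p + U.dim (U.cmProd F (blkB Ξ))) ⊓ B (U.cmProd F Ξ) (p + U.dim (U.cmProd F (blkB Ξ))) :=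
    he
  exact Submodule.mem_inf.mpr
    ⟨h F n m Ξ pA pB hP ω hω p e (Submodule.mem_inf.mp he').1,
      hB F n m Ξ pA pB hP ω hω p e (Submodule.mem_inf.mp he').2⟩

end Universe

end HodgeCM

end
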